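import Mathlib
import Literature.NumberTheory.Transcendental.KZCalculusProofs
import Literature.NumberTheory.Transcendental.SemialgebraicMapsProofs
import Literature.NumberTheory.Transcendental.KZSemialgebraicComplex
import Literature.NumberTheory.Transcendental.KZLogCalculusProofs
import HarnessLib

/-!
# `OffTetraSectorKernel`, line `deform-to-the-oracle`: the Putnam self-similarity (stub `stub_putnam`)

Stub `stub_putnam` of the crux `OffTetraSectorKernel` (stmt-KontsevichZagierPeriods-10557, route
HyperbolicBloch), one station of the Catalan calibration
`[(0,1)², 1/(1+x²y²)] ~ [T(i), t⁻³]`: Kontsevich–Zagier's rule (2) for the RATIONAL self-map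
`Φ(s, y) = ((1 − s)/(1 + s), 2y/(1 + s))` (coordinates `x 0 = s`, `x 1 = y`) of the planar pieces
carrying the density `g(s, y) = 1/((1 + s²) y)`. The map `s ↦ (1 − s)/(1 + s)` is the involution
behind the Putnam integral `∫₀¹ log(1 + s) ds/(1 + s²) = (π/8) log 2`; with `w = (1 − s)/(1 + s)` one
has `1 + w = 2/(1 + s)` and `1 + w² = 2(1 + s²)/(1 + s)²`, so `Φ` maps
`A = {0 < s < 1, 1 < y ≤ 1 + s}` BIJECTIVELY onto `A* = {0 < w < 1, 1 + w < y' ≤ 2}` (inverse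
`s = (1 − w)/(1 + w)`, `y = y'/(1 + w)`), with derivative `[[−2/(1+s)², 0], [−2y/(1+s)², 2/(1+s)]]`
of determinant `−4/(1 + s)³`, and the Jacobian identity `g(s, y) = g(Φ(s, y)) · 4/(1 + s)³` holds.
Hence `[A, g] − [A*, g]` is ONE element of `KZ.changeOfVariablesRel`, and a representation
`[A*, g]` EXISTS: `A* = Φ '' A` is `ℚ`-semialgebraic (Tarski–Seidenberg,
`IsSemialgebraicMapOn.isSemialgebraic_image_holds`), `g` is a quotient of rational polynomials with
denominator `(1 + w²) y' > 0` on `A*`, and `g` is integrable on `Φ '' A` by Mathlib's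
change-of-variables criterion `MeasureTheory.integrableOn_image_iff_integrableOn_abs_det_fderiv_smul`
(the pulled-back density `|det DΦ| · g ∘ Φ` IS `g = A.integrand` on `A`).

References: M. Kontsevich, D. Zagier, *Periods* (2001), §1.2 rule (2); J. Bochnak, M. Coste,
M.-F. Roy, *Real Algebraic Geometry* (1998), §2.2 (Prop. 2.2.6, 2.2.7).
-/

noncomputable section

open Set MeasureTheory MvPolynomial
open Literature.NumberTheory.Transcendental Literature.ModelTheory.ExponentialFields

namespace Summit.KontsevichZagierPeriods.HyperbolicBloch.OffTetraSectorKernel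

/-! ## Algebra of the Putnam map `Φ(s, y) = ((1 − s)/(1 + s), 2y/(1 + s))` -/

/-- The coordinates of the Putnam map. [folklore] -/
theorem putnam_apply (Φ : (Fin 2 → ℝ) → (Fin 2 → ℝ))
    (hΦ : ∀ v, Φ v = ![(1 - v 0) / (1 + v 0), 2 * v 1 / (1 + v 0)]) (v : Fin 2 → ℝ) :
    Φ v 0 = (1 - v 0) / (1 + v 0) ∧ Φ v 1 = 2 * v 1 / (1 + v 0) := by
  rw [hΦ v]
  exact ⟨rfl, rfl⟩

/-- `1 + w = 2/(1 + s)` for `w = (1 − s)/(1 + s)` (`1 + s ≠ 0`). [folklore] -/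
theorem putnam_one_add {s : ℝ} (hs : 1 + s ≠ 0) : 1 + (1 - s) / (1 + s) = 2 / (1 + s) := by
  field_simp
  ring

/-- `1 + w² = 2(1 + s²)/(1 + s)²` for `w = (1 − s)/(1 + s)` (`1 + s ≠ 0`). [folklore] -/
theorem putnam_one_add_sq {s : ℝ} (hs : 1 + s ≠ 0) :
    1 + ((1 - s) / (1 + s)) ^ 2 = 2 * (1 + s ^ 2) / (1 + s) ^ 2 := by
  field_simp
  ring

/-- **The Jacobian identity** `g(s, y) = g(Φ(s, y)) · |−4/(1 + s)³|` for `1 + s > 0`,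
`g(s, y) = 1/((1 + s²) y)`. [folklore] -/
theorem putnam_jacobian {s : ℝ} (y : ℝ) (hs : 0 < 1 + s) :
    1 / ((1 + s ^ 2) * y) =
      1 / ((1 + ((1 - s) / (1 + s)) ^ 2) * (2 * y / (1 + s))) * |-4 / (1 + s) ^ 3| := by
  have h1 : (1 + s) ≠ 0 := hs.ne'
  have h2 : (1 + s ^ 2) ≠ 0 := by positivity
  rw [putnam_one_add_sq h1, abs_of_neg (div_neg_of_neg_of_pos (by norm_num) (pow_pos hs 3))]
  rcases eq_or_ne y 0 with rfl | hy
  · simp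
  field_simp
  ring

/-- **The image of `A = {0 < s < 1, 1 < y ≤ 1 + s}` under the Putnam map is
`A* = {0 < w < 1, 1 + w < y' ≤ 2}`** (`1 + w = 2/(1 + s)`; inverse `s = (1 − w)/(1 + w)`,
`y = y'/(1 + w)`). [folklore] -/
theorem putnam_image (Φ : (Fin 2 → ℝ) → (Fin 2 → ℝ))
    (hΦ : ∀ v, Φ v = ![(1 - v 0) / (1 + v 0), 2 * v 1 / (1 + v 0)]) :
    Φ '' {x | 0 < x 0 ∧ x 0 < 1 ∧ 1 < x 1 ∧ x 1 ≤ 1 + x 0} =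
      {x | 0 < x 0 ∧ x 0 < 1 ∧ 1 + x 0 < x 1 ∧ x 1 ≤ 2} := by
  ext w
  constructor
  · -- `Φ` maps `A` into `A*`
    rintro ⟨v, ⟨h0, h1, hy, hy'⟩, rfl⟩
    obtain ⟨e0, e1⟩ := putnam_apply Φ hΦ v
    simp only [mem_setOf_eq, e0, e1]
    have hp : 0 < 1 + v 0 := by linarith
    refine ⟨div_pos (by linarith) hp, (div_lt_one hp).2 (by linarith), ?_, ?_⟩
    · rw [putnam_one_add hp.ne', div_lt_div_iff_of_pos_right hp]
      linarith
    · rw [div_le_iff₀ hp]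
      linarith
  · -- `A*` is covered: `s = (1 − w)/(1 + w)`, `y = y'/(1 + w)`
    rintro ⟨h0, h1, hy, hy'⟩
    have hp : 0 < 1 + w 0 := by linarith
    have hs : 1 + (1 - w 0) / (1 + w 0) = 2 / (1 + w 0) := putnam_one_add hp.ne'
    refine ⟨![(1 - w 0) / (1 + w 0), w 1 / (1 + w 0)], ?_, ?_⟩
    · simp only [mem_setOf_eq, Matrix.cons_val_zero, Matrix.cons_val_one, Matrix.cons_val_fin_one]
      refine ⟨div_pos (by linarith) hp, (div_lt_one hp).2 (by linarith), (one_lt_div hp).2 hy, ?_⟩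
      rw [hs, div_le_div_iff_of_pos_right hp]
      exact hy'
    · rw [hΦ]
      funext i
      fin_cases i
      · simp only [Fin.zero_eta, Fin.isValue, Matrix.cons_val_zero, Matrix.cons_val_one,
          Matrix.cons_val_fin_one]
        field_simp
        ring
      · simp only [Fin.mk_one, Fin.isValue, Matrix.cons_val_one, Matrix.cons_val_zero,
          Matrix.cons_val_fin_one]
        rw [hs]
        field_simp

/-- The Putnam map is injective on `{1 + s ≠ 0}`: `s ↦ (1 − s)/(1 + s)` is injective there, and for
fixed `s` the second coordinate is linear in `y` with slope `2/(1 + s) ≠ 0`. [folklore] -/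
theorem putnam_injOn (Φ : (Fin 2 → ℝ) → (Fin 2 → ℝ))
    (hΦ : ∀ v, Φ v = ![(1 - v 0) / (1 + v 0), 2 * v 1 / (1 + v 0)]) :
    InjOn Φ {v | 1 + v 0 ≠ 0} := by
  intro v hv v' hv' h
  obtain ⟨e0, e1⟩ := putnam_apply Φ hΦ v
  obtain ⟨e0', e1'⟩ := putnam_apply Φ hΦ v'
  have hs : v 0 = v' 0 := by
    have h0 : Φ v 0 = Φ v' 0 := by rw [h]
    rw [e0, e0', div_eq_div_iff hv hv'] at h0
    linarith
  have hy : v 1 = v' 1 := by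
    have h1 : Φ v 1 = Φ v' 1 := by rw [h]
    rw [e1, e1', ← hs, div_eq_div_iff hv hv] at h1
    have := mul_right_cancel₀ hv h1
    linarith
  funext i
  fin_cases i
  exacts [hs, hy]

/-! ## Semialgebraicity -/

/-- The Putnam map is a `ℚ`-semialgebraic map on every `ℚ`-semialgebraic `σ ⊆ {1 + s ≠ 0}`: its
coordinates are quotients of rational polynomials with non-vanishing denominators.
[cite: KontsevichZagier2001, §1.1] -/
theorem putnam_isSemialgebraicMapOn (Φ : (Fin 2 → ℝ) → (Fin 2 → ℝ))
    (hΦ : ∀ v, Φ v = ![(1 - v 0) / (1 + v 0), 2 * v 1 / (1 + v 0)]) {σ : Set (Fin 2 → ℝ)}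
    (hσ : IsSemialgebraic ℚ σ) (hne : ∀ v ∈ σ, 1 + v 0 ≠ 0) : IsSemialgebraicMapOn ℚ σ Φ := by
  have hq : ∀ v ∈ σ, aeval v (1 + X 0 : MvPolynomial (Fin 2) ℚ) ≠ 0 := fun v hv => by
    simpa using hne v hv
  refine IsSemialgebraicMapOn.of_forall hσ fun j => ?_
  fin_cases j
  · exact (isSemialgebraicFunOn_aeval_div_aeval hσ (1 - X 0) (1 + X 0) hq).congr fun v _ => by
      simp [(putnam_apply Φ hΦ v).1]
  · exact (isSemialgebraicFunOn_aeval_div_aeval hσ (2 * X 1) (1 + X 0) hq).congr fun v _ => by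
      simp [(putnam_apply Φ hΦ v).2]

/-- The density `g = 1/((1 + s²) y)` is a `ℚ`-semialgebraic function on every `ℚ`-semialgebraic
`σ ⊆ {y ≠ 0}` (a quotient of rational polynomials, denominator `(1 + s²) y ≠ 0`).
[cite: KontsevichZagier2001, §1.1] -/
theorem putnam_isSemialgebraicFunOn_g {σ : Set (Fin 2 → ℝ)} (hσ : IsSemialgebraic ℚ σ)
    (hne : ∀ v ∈ σ, v 1 ≠ 0) :
    IsSemialgebraicFunOn ℚ σ (fun x : Fin 2 → ℝ => 1 / ((1 + x 0 ^ 2) * x 1)) := by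
  have hq : ∀ v ∈ σ, aeval v ((1 + X 0 ^ 2) * X 1 : MvPolynomial (Fin 2) ℚ) ≠ 0 := fun v hv => by
    have h : (1 + v 0 ^ 2) * v 1 ≠ 0 := mul_ne_zero (by positivity) (hne v hv)
    simpa using h
  exact (isSemialgebraicFunOn_aeval_div_aeval hσ 1 ((1 + X 0 ^ 2) * X 1) hq).congr fun v _ => by
    simp

/-! ## The derivative -/

/-- **The derivative of the Putnam map and its determinant.** At a point with `1 + s ≠ 0`, `Φ` has
the Fréchet derivative of matrix `[[−2/(1+s)², 0], [−2y/(1+s)², 2/(1+s)]]`, of determinant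
`−4/(1 + s)³`. [folklore] -/
theorem putnam_hasFDerivAt_det (Φ : (Fin 2 → ℝ) → (Fin 2 → ℝ))
    (hΦ : ∀ v, Φ v = ![(1 - v 0) / (1 + v 0), 2 * v 1 / (1 + v 0)]) {v : Fin 2 → ℝ}
    (hv : 1 + v 0 ≠ 0) :
    ∃ L : (Fin 2 → ℝ) →L[ℝ] (Fin 2 → ℝ), HasFDerivAt Φ L v ∧ L.det = -4 / (1 + v 0) ^ 3 := by
  set M : Matrix (Fin 2) (Fin 2) ℝ :=
    !![-2 / (1 + v 0) ^ 2, 0; -(2 * v 1) / (1 + v 0) ^ 2, 2 / (1 + v 0)] with hM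
  refine ⟨LinearMap.toContinuousLinearMap (Matrix.toLin' M), ?_, ?_⟩
  · -- derivative, componentwise
    have e0 : HasFDerivAt (fun x : Fin 2 → ℝ => x 0) (ContinuousLinearMap.proj 0) v :=
      hasFDerivAt_apply (𝕜 := ℝ) 0 v
    have e1 : HasFDerivAt (fun x : Fin 2 → ℝ => x 1) (ContinuousLinearMap.proj 1) v :=
      hasFDerivAt_apply (𝕜 := ℝ) 1 v
    -- the one-variable maps `s ↦ (1 − s)/(1 + s)` and `s ↦ (1 + s)⁻¹`
    have hm : HasDerivAt (fun s : ℝ => (1 - s) / (1 + s)) (-2 / (1 + v 0) ^ 2) (v 0) :=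
      (((hasDerivAt_id' (v 0)).const_sub 1).fun_div ((hasDerivAt_id' (v 0)).const_add 1)
        hv).congr_deriv (by ring)
    have hi : HasDerivAt (fun s : ℝ => (1 + s)⁻¹) (-1 / (1 + v 0) ^ 2) (v 0) :=
      ((hasDerivAt_id' (v 0)).const_add 1).fun_inv hv
    have h0 : HasFDerivAt (fun x => Φ x 0)
        ((ContinuousLinearMap.proj 0).comp (LinearMap.toContinuousLinearMap (Matrix.toLin' M)))
        v := by
      have hf : (fun x => Φ x 0) = (fun s : ℝ => (1 - s) / (1 + s)) ∘ fun x : Fin 2 → ℝ => x 0 := by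
        funext x
        exact (putnam_apply Φ hΦ x).1
      rw [hf]
      refine (hm.comp_hasFDerivAt v e0).congr_fderiv (ContinuousLinearMap.ext fun u => ?_)
      simp [hM, Matrix.toLin'_apply, dotProduct, Fin.sum_univ_two]
    have h1 : HasFDerivAt (fun x => Φ x 1)
        ((ContinuousLinearMap.proj 1).comp (LinearMap.toContinuousLinearMap (Matrix.toLin' M)))
        v := by
      have hf : (fun x => Φ x 1) = fun x : Fin 2 → ℝ =>
          2 * x 1 * ((fun s : ℝ => (1 + s)⁻¹) ∘ fun x : Fin 2 → ℝ => x 0) x := by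
        funext x
        rw [(putnam_apply Φ hΦ x).2, div_eq_mul_inv]
        rfl
      rw [hf]
      refine ((e1.const_mul 2).fun_mul (hi.comp_hasFDerivAt v e0)).congr_fderiv
        (ContinuousLinearMap.ext fun u => ?_)
      simp [hM, Matrix.toLin'_apply, dotProduct, Fin.sum_univ_two]
      field_simp
    refine hasFDerivAt_pi'' fun i => ?_
    fin_cases i
    exacts [h0, h1]
  · -- determinant
    rw [LinearMap.det_toContinuousLinearMap, LinearMap.det_toLin', Matrix.det_fin_two_of]
    field_simp
    ring

/-! ## The stub -/

/-- **STUB `stub_putnam`** (rule 2, one `changeOfVariablesRel` instance + existence of the image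
representation): the map `Φ(s, y) = ((1 − s)/(1 + s), 2y/(1 + s))`, `|det DΦ| = 4/(1 + s)³`, maps
`A = {0 < s < 1, 1 < y ≤ 1 + s}` onto `A* = {0 < w < 1, 1 + w < y' ≤ 2}` with
`g = (g ∘ Φ) · |det DΦ|`, `g(s, y) = 1/((1 + s²) y)` — the self-similarity behind
`∫₀¹ log(1 + s) ds/(1 + s²) = (π/8) log 2`. A representation `[A*, g]` EXISTS (semialgebraic image
by Tarski–Seidenberg; quotient integrand with denominator `(1 + w²) y' > 0`; integrable by the
change-of-variables criterion, the pulled-back density being `g = A.integrand` on `A`), and EVERY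
such representation is KZ-equivalent to `A` by the single move `[A] − [A*] ∈ changeOfVariablesRel`.
[cite: KontsevichZagier2001, §1.2 rule (2)] -/
theorem stub_putnam : ∀ A : Literature.NumberTheory.Transcendental.KZ.IntegralRep 2, A.domain = {x | 0 < x 0 ∧ x 0 < 1 ∧ 1 < x 1 ∧ x 1 ≤ 1 + x 0} → Set.EqOn A.integrand (fun x => 1 / ((1 + x 0 ^ 2) * x 1)) A.domain → (∃ As : Literature.NumberTheory.Transcendental.KZ.IntegralRep 2, As.domain = {x | 0 < x 0 ∧ x 0 < 1 ∧ 1 + x 0 < x 1 ∧ x 1 ≤ 2} ∧ Set.EqOn As.integrand (fun x => 1 / ((1 + x 0 ^ 2) * x 1)) As.domain) ∧ (∀ As : Literature.NumberTheory.Transcendental.KZ.IntegralRep 2, As.domain = {x | 0 < x 0 ∧ x 0 < 1 ∧ 1 + x 0 < x 1 ∧ x 1 ≤ 2} → Set.EqOn As.integrand (fun x => 1 / ((1 + x 0 ^ 2) * x 1)) As.domain → Literature.NumberTheory.Transcendental.KZ.Equivalent A As) := by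
  intro A hA hAi
  -- the move `Φ(s, y) = ((1 − s)/(1 + s), 2y/(1 + s))`
  obtain ⟨Φ, hΦ⟩ : ∃ Φ : (Fin 2 → ℝ) → (Fin 2 → ℝ),
      ∀ v, Φ v = ![(1 - v 0) / (1 + v 0), 2 * v 1 / (1 + v 0)] := ⟨_, fun _ => rfl⟩
  have hpos : ∀ x ∈ A.domain, 0 < 1 + x 0 := fun x hx => by
    rw [hA] at hx
    linarith [hx.1]
  -- the image is `A*`
  have himage : Φ '' A.domain = {x | 0 < x 0 ∧ x 0 < 1 ∧ 1 + x 0 < x 1 ∧ x 1 ≤ 2} := by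
    rw [hA]
    exact putnam_image Φ hΦ
  -- the four data of the move
  have hΦsa : IsSemialgebraicMapOn ℚ A.domain Φ :=
    putnam_isSemialgebraicMapOn Φ hΦ A.isSemialgebraic_domain fun x hx => (hpos x hx).ne'
  have hinj : InjOn Φ A.domain := (putnam_injOn Φ hΦ).mono fun x hx => (hpos x hx).ne'
  have hex : ∀ x : Fin 2 → ℝ, ∃ L : (Fin 2 → ℝ) →L[ℝ] (Fin 2 → ℝ), 1 + x 0 ≠ 0 →
      HasFDerivAt Φ L x ∧ L.det = -4 / (1 + x 0) ^ 3 := by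
    intro x
    by_cases hx : 1 + x 0 ≠ 0
    · obtain ⟨L, hL, hdet⟩ := putnam_hasFDerivAt_det Φ hΦ hx
      exact ⟨L, fun _ => ⟨hL, hdet⟩⟩
    · exact ⟨0, fun h => (hx h).elim⟩
  choose Φ' hΦ' using hex
  have hderiv : ∀ x ∈ A.domain, HasFDerivWithinAt Φ (Φ' x) A.domain x := fun x hx =>
    ((hΦ' x (hpos x hx).ne').1).hasFDerivWithinAt
  have hjac : ∀ x ∈ A.domain, A.integrand x =
      1 / ((1 + Φ x 0 ^ 2) * Φ x 1) * |(Φ' x).det| := by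
    intro x hx
    obtain ⟨e0, e1⟩ := putnam_apply Φ hΦ x
    rw [hAi hx, (hΦ' x (hpos x hx).ne').2, e0, e1]
    exact putnam_jacobian (x 1) (hpos x hx)
  have hmeas : MeasurableSet A.domain := KZ.IntegralRep.measurableSet_domain_holds A
  -- EXISTENCE of `[A*, g]`: semialgebraic image, quotient integrand, change of variables
  have hT : IsSemialgebraic ℚ (Φ '' A.domain) :=
    IsSemialgebraicMapOn.isSemialgebraic_image_holds hΦsa subset_rfl A.isSemialgebraic_domain
  have hne : ∀ w ∈ Φ '' A.domain, w 1 ≠ 0 := by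
    rw [himage]
    rintro w ⟨h0, -, hy, -⟩
    exact (show (0 : ℝ) < w 1 by linarith).ne'
  have hF := putnam_isSemialgebraicFunOn_g hT hne
  have hI : IntegrableOn (fun x : Fin 2 → ℝ => 1 / ((1 + x 0 ^ 2) * x 1)) (Φ '' A.domain) := by
    rw [integrableOn_image_iff_integrableOn_abs_det_fderiv_smul volume hmeas hderiv hinj]
    refine A.integrableOn.congr_fun (fun x hx => ?_) hmeas
    rw [hjac x hx, smul_eq_mul, mul_comm]
  refine ⟨⟨⟨Φ '' A.domain, _, hT, hF, hI⟩, himage, fun _ _ => rfl⟩, ?_⟩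
  -- EVERY `[A*, g]` is one change-of-variables move away from `A`
  intro As hAs hAsi
  refine KZ.changeOfVariablesRel_subset_relations
    ⟨2, A, As, Φ, Φ', hΦsa, hderiv, hinj, hAs.trans himage.symm, fun x hx => ?_, rfl⟩
  have hx' : Φ x ∈ As.domain := by
    rw [hAs, ← himage]
    exact mem_image_of_mem Φ hx
  rw [hjac x hx, hAsi hx']

end Summit.KontsevichZagierPeriods.HyperbolicBloch.OffTetraSectorKernel

end
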